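import Summits.ValiantsHypothesis.ValiantsHypothesis.Theorems.GrenetZeonDualUnipotentThreeHalvesSlowCoreLedger

/-!
# `GrenetZeon.DualUnipotentThreeHalves` (stmt-ValiantsHypothesis-24318), row r12 (RANK ROW) — part (G7a): WOODBURY WITH A NILPOTENT CAPACITANCE

Port (val-lit-p3 g18; val-idea-crit-7 g4 V48 §5 PORT SPEC «(G7a) GO NOW», desk #409) of §1 of val-idea-29 g8's `Cruxes/DualUnipotentThreeHalves/RankRow.lean`
(tree sha16 cb24ef162c2de972) — the six abstract ring identities VERBATIM by name, namespace `…Cruxes.DualUnipotentThreeHalves.RankRow` →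
`…Theorems.GrenetZeon.RankRow`; §2 (the typed provider signatures `RankRow` / `RankRowConst`) is deliberately NOT ported (crit-7 V48: an unproved closed
`def … : Prop` in Theorems is fact debt; the real r12 port is `theorem rankRow_holds : RankRow`, eng-sized, routes O1–O3 of V48).

§1 **Woodbury with a nilpotent capacitance**, abstract ring form (both sides): `(M - S) * (R' + R' * S * N * R') = 1` from `M * R' = 1` and
`(1 - R' * S) * N = 1`, and the mirror identity; the capacitance `N = ∑_{i<r} G^i` from `G ^ r = 0` (`one_sub_mul_geom_sum_of_pow_eq_zero`,
`geom_sum_mul_one_sub_of_pow_eq_zero`); `sub_mul_woodbury`, `woodbury_mul_sub`, ★ `woodbury_of_transfer_pow_eq_zero`, ★ `resolvent_add_of_transfer_pow_eq_zero`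
(`(1 − u(A+S))⁻¹ = R_A + R_A·uS·N·R_A` with the transfer `G = R_A·uS` nilpotent).  In the rank row (memo `MEMO-idea29-g8-rank-row.md` §1; crit-7 V48
THEOREM re-derived ✓): `M = 1 − u·A'` (`A'` strictly upper triangular in a constant flag), `S = u·S₀` (skew part of the base point, rank `≤ r`), `R' = Σ_j u^j A'^j`,
`G = R'·S` nilpotent of index `≤ r+1` because the closed value cone is a nil space ⇒ every `u`-coefficient of `Σ_p u^p (B(x+sv))^p` has `deg_s ≤ (r+2)·κ_q` — a LEDGER.

WORDS OF RECORD (crit-7 g4 V48): «row r12 — the RANK ROW, ADOPTED as a certified-cheap CLASS ROW on paper ((c) with c ≈ 2√(r+2) on «triangular up to a skew part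
of bounded rank»); THIS FILE = its kernel core, the Woodbury identities (TOOL, zero fact debt, reusable by r3/port-2); never an `IrreducibleInv` constituent;
NOT progress on (c) `LongMassSlowLawInv` (RESEARCH — OPEN); 24318 / S3 / R2ᵖ OPEN; VP ≠ VNP is NOT proved».  Helper (`--supports stmt-ValiantsHypothesis-24318
--as helper`); lead val-port-2 g4.  Credit: val-idea-29 g8 (identities and the row); the identity itself is classical (Woodbury / Sherman–Morrison).
No instances, no notation, no named facts. [folklore]
-/

set_option linter.dupNamespace false
set_option autoImplicit false

namespace Summit.ValiantsHypothesis.ValiantsHypothesis.Theorems.GrenetZeon.RankRow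

open scoped BigOperators
open Finset (range)

/-! ## §1 Woodbury with a nilpotent capacitance -/

section Ring

variable {R : Type*} [Ring R]

/-- **Capacitance.**  If `G ^ r = 0` then `N := ∑_{i<r} G^i` is a two-sided inverse of `1 - G`. -/
theorem one_sub_mul_geom_sum_of_pow_eq_zero (G : R) (r : ℕ) (hG : G ^ r = 0) :
    (1 - G) * (∑ i ∈ range r, G ^ i) = 1 := by
  rw [mul_neg_geom_sum, hG, sub_zero]

/-- Capacitance, mirror form: `(∑_{i<r} G^i) * (1 - G) = 1` when `G ^ r = 0`. [folklore] -/
theorem geom_sum_mul_one_sub_of_pow_eq_zero (G : R) (r : ℕ) (hG : G ^ r = 0) :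
    (∑ i ∈ range r, G ^ i) * (1 - G) = 1 := by
  rw [geom_sum_mul_neg, hG, sub_zero]

/-- **Woodbury, right inverse.**  `M R' = 1` and `(1 - R' S) N = 1` give `(M - S)(R' + R' S N R') = 1`.
(In the rank row: `M = 1 - uA'`, `S = uS₀`, `R' = ∑ u^j A'^j`, `N` the capacitance of the nilpotent transfer `R' S`.) -/
theorem sub_mul_woodbury (M R' S N : R) (hMR : M * R' = 1) (hN : (1 - R' * S) * N = 1) :
    (M - S) * (R' + R' * S * N * R') = 1 := by
  have h : (M - S) * (R' + R' * S * N * R')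
      = M * R' + S * (((1 - R' * S) * N) - 1) * R' + (M * R' - 1) * S * N * R' := by
    noncomm_ring
  rw [h, hN, hMR]
  noncomm_ring

/-- **Woodbury, left inverse.**  `R' M = 1` and `N (1 - R' S) = 1` give `(R' + R' S N R')(M - S) = 1`. -/
theorem woodbury_mul_sub (M R' S N : R) (hRM : R' * M = 1) (hN : N * (1 - R' * S) = 1) :
    (R' + R' * S * N * R') * (M - S) = 1 := by
  have h : (R' + R' * S * N * R') * (M - S)
      = R' * M + R' * S * ((N * (1 - R' * S)) - 1) + R' * S * N * (R' * M - 1) := by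
    noncomm_ring
  rw [h, hN, hRM]
  noncomm_ring

/-- **Woodbury with a nilpotent capacitance** (the form used by the rank row): if `R'` is a two-sided inverse of `M` and the
transfer `G := R' * S` satisfies `G ^ r = 0`, then `R' + R' S (∑_{i<r} G^i) R'` is a two-sided inverse of `M - S`. -/
theorem woodbury_of_transfer_pow_eq_zero (M R' S : R) (r : ℕ) (hMR : M * R' = 1) (hRM : R' * M = 1)
    (hG : (R' * S) ^ r = 0) :
    (M - S) * (R' + R' * S * (∑ i ∈ range r, (R' * S) ^ i) * R') = 1 ∧
      (R' + R' * S * (∑ i ∈ range r, (R' * S) ^ i) * R') * (M - S) = 1 :=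
  ⟨sub_mul_woodbury M R' S _ hMR (one_sub_mul_geom_sum_of_pow_eq_zero _ r hG),
    woodbury_mul_sub M R' S _ hRM (geom_sum_mul_one_sub_of_pow_eq_zero _ r hG)⟩

/-- The resolvent form: with `M = 1 - A` and `R' = ∑_{j<h} A^j` for `A ^ h = 0`, the series of `A + S` is
`R' + R' S N R'` whenever the transfer `R' S` is nilpotent — `(1 - (A + S)) * (R' + R' S N R') = 1`. -/
theorem resolvent_add_of_transfer_pow_eq_zero (A S : R) (h r : ℕ) (hA : A ^ h = 0)
    (hG : ((∑ j ∈ range h, A ^ j) * S) ^ r = 0) :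
    (1 - (A + S)) * ((∑ j ∈ range h, A ^ j) + (∑ j ∈ range h, A ^ j) * S *
        (∑ i ∈ range r, ((∑ j ∈ range h, A ^ j) * S) ^ i) * (∑ j ∈ range h, A ^ j)) = 1 := by
  have h1 : (1 : R) - (A + S) = (1 - A) - S := by noncomm_ring
  rw [h1]
  exact (woodbury_of_transfer_pow_eq_zero (1 - A) _ S r
    (one_sub_mul_geom_sum_of_pow_eq_zero A h hA) (geom_sum_mul_one_sub_of_pow_eq_zero A h hA) hG).1

end Ring

end Summit.ValiantsHypothesis.ValiantsHypothesis.Theorems.GrenetZeon.RankRow
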